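import Summits.ABC.StewartYu.PadicTwistSetup
import Summits.ABC.StewartYu.PadicTwistExists
import Literature.NumberTheory.Transcendental.PadicCW77Reduction
import HarnessLib

/-!
# Cell abc-stewartyu, WP-Y3 (xi-b): from the core bound of the twisted machine to the W80-SHAPE
# ENGINE for arbitrary rational `p`-adic units at `p ≡ 3 (mod 4)`

`Summits/ABC/StewartYu/PadicTwistEngine.lean` — cell `abc-stewartyu` (seat p2; cruxes
`W80ThreeModFour` stmt-ABC-19485 (routes PadicPrimesW80TwoThirds / PadicPrimesW80OddRadOne) and
`FinBoundThreeModFour` stmt-ABC-19455).  One `def : Prop` + theorems; no named fact.  Depends only on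
`PadicTwistSetup` / `PadicTwistExists` (the descent enters through `TwistCoreBound`).

* `TwistCoreBound C` — the target of the parameter system: for every twisted set-up `S` with ODD
  twist order `G ≤ p` (Kummer-free, multiplicatively independent signed generators, heights
  `h ≤ V`, floors `log p ≤ V ≤ Vmax`, `log p ≤ W`),
  `‖Λ₀‖_p > exp(−C(d+1) · G · ∏ᵢ(Vᵢ/log p) · (W + log 2Vmax) · log(2Vmax))`;
* sign lemmas `prod_sign_eq`, `not_isSquare_prod_sign_mul`, `indep_sign_mul`;
* `engineW80_of_coreBound` — **the reduction of the symmetric W80-shape engine** (verbatim the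
  hypothesis `hE` of p3's `YuNinetyW80.threeModFour_of_w80Engine`) to `TwistCoreBound`: for units
  `α₁,…,α_m` at `p ≡ 3 (mod 4)` pick signs and odd-order roots `ηᵢ` (`PadicTwistExists`), eliminate a
  coefficient of minimal `p`-adic order (Yu's (2.17)), transport the signed Kummer condition, the
  independence and the heights to the twisted set-up, and read `ord_p(∏ αⱼ^{bⱼ} − 1)` off `‖Λ‖`:
  if the product of the chosen signs is `−1` the twisted product cannot be principal (a principal
  unit of odd order `G` is `1`, but `(−ρ_b)^G = −1`), so that case does not occur when
  `ord_p(∏ αⱼ^{bⱼ} − 1) ≥ 1`; otherwise `‖Λ‖ = ‖∏ αⱼ^{bⱼ} − 1‖_p` and the class price `G = (p−1)/2 < p/2`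
  turns `2U/log p` into `C(m) · p · ∏(Vⱼ/log p) · (W + log 2Vmax) · log(2Vmax)`.

## References
* [Yu1990] K. Yu, *Linear forms in p-adic logarithms II*, Compositio Math. 74 (1990), Theorem 2.1
  and §2 (2.17)–(2.25).
* [Waldschmidt1980] M. Waldschmidt, Acta Arith. 37 (1980), §3.6 (the symmetric reduction).
-/

noncomputable section

open NormedSpace Finset IsUltrametricDist Height
open Literature.NumberTheory.Transcendental
open Literature.NumberTheory.Transcendental.PadicCW77 (reidxEquiv reidxEquiv_castSucc reidxEquiv_last
  snoc_comp_succAbove one_div_le_norm_intCast)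
open scoped Nat

namespace Summit.ABC.StewartYu

namespace TwistSetup

/-! ### The core bound -/

/-- **The core bound of the twisted machine** (target of the parameter system and the sizes): for
every twisted set-up with ODD twist order `G ≤ p` whose signed generators are Kummer-free and multiplicatively independent, with
heights `h(αⱼ) ≤ Vⱼ`, `h(θ) ≤ V_θ`, floors `log p ≤ Vⱼ, V_θ ≤ V_max`, coefficients
`log max(3,|bⱼ|), log max(3,|b_θ|) ≤ W` and `log p ≤ W`:
`‖Λ₀‖_p > exp(−C(d+1) · G · (∏(Vⱼ/log p) · V_θ/log p) · (W + log 2V_max) · log(2V_max))`.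
[cite: Yu1990, Theorem 2.1] [cite: Waldschmidt1980, Prop. 3.8 (p. 263)] -/
def TwistCoreBound (C : ℕ → ℝ) : Prop :=
  ∀ (p : ℕ) [Fact p.Prime] (S : TwistSetup p) (V : Fin S.d → ℝ) (Vθ Vmax W : ℝ), Odd S.G → S.G ≤ p →
    (∀ T : Finset (Fin (S.d + 1)), T.Nonempty → ¬ IsSquare (∏ i ∈ T, S.toQ.all i)) →
    (∀ μ : Fin (S.d + 1) → ℤ, ∏ i, S.toQ.all i ^ μ i = 1 → μ = 0) →
    (∀ j, logHeight₁ (S.α j) ≤ V j) → logHeight₁ S.θ ≤ Vθ →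
    (∀ j, Real.log p ≤ V j) → Real.log p ≤ Vθ → (∀ j, V j ≤ Vmax) → Vθ ≤ Vmax →
    (∀ j, Real.log (max 3 (|S.b j| : ℝ)) ≤ W) → Real.log (max 3 (|S.bθ| : ℝ)) ≤ W → Real.log p ≤ W →
    Real.exp (-(C (S.d + 1) * S.G * ((∏ j, V j / Real.log p) * (Vθ / Real.log p)) *
      (W + Real.log (2 * Vmax)) * Real.log (2 * Vmax))) < ‖S.Λ₀‖

/-! ### Signs -/

/-- A product of signs `±1` is a sign. [folklore] -/
theorem prod_sign_eq {ι : Type*} (s : Finset ι) (σ : ι → ℤ) (hσ : ∀ i, σ i = 1 ∨ σ i = -1)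
    (e : ι → ℤ) : (∏ i ∈ s, (σ i : ℚ) ^ e i) = 1 ∨ (∏ i ∈ s, (σ i : ℚ) ^ e i) = -1 := by
  classical
  induction s using Finset.induction_on with
  | empty => simp
  | insert a s ha ih =>
    rw [prod_insert ha]
    have h1 : ((σ a : ℚ) ^ e a) = 1 ∨ ((σ a : ℚ) ^ e a) = -1 := by
      rcases hσ a with h | h
      · left; rw [h]; simp
      · rw [h]; push_cast
        rcases Int.even_or_odd (e a) with he | ho
        · left; exact he.neg_one_zpow
        · right; exact ho.neg_one_zpow
    rcases h1 with h1 | h1 <;> rcases ih with h2 | h2 <;> rw [h1, h2] <;> norm_num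

/-- Signed generators stay Kummer-free: if no signed product over a non-empty `T` of the `αᵢ` is a
square, the same holds for `σᵢ αᵢ`, `σᵢ = ±1`. [folklore] -/
theorem not_isSquare_prod_sign_mul {n : ℕ} (α : Fin n → ℚ) (σ : Fin n → ℤ)
    (hσ : ∀ i, σ i = 1 ∨ σ i = -1)
    (hK : ∀ T : Finset (Fin n), T.Nonempty → ¬ IsSquare (∏ i ∈ T, α i) ∧ ¬ IsSquare (-∏ i ∈ T, α i))
    (T : Finset (Fin n)) (hT : T.Nonempty) : ¬ IsSquare (∏ i ∈ T, (σ i : ℚ) * α i) := by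
  rw [prod_mul_distrib]
  have hs := prod_sign_eq T σ hσ (fun _ => 1)
  simp only [zpow_one] at hs
  rcases hs with h | h
  · rw [h, one_mul]; exact (hK T hT).1
  · rw [h, neg_one_mul]; exact (hK T hT).2

/-- Signed generators stay multiplicatively independent. [folklore] -/
theorem indep_sign_mul {n : ℕ} (α : Fin n → ℚ) (σ : Fin n → ℤ) (hσ : ∀ i, σ i = 1 ∨ σ i = -1)
    (hμ : ∀ μ : Fin n → ℤ, ∏ i, α i ^ μ i = 1 → μ = 0) (μ : Fin n → ℤ)
    (h : ∏ i, ((σ i : ℚ) * α i) ^ μ i = 1) : μ = 0 := by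
  have h2 : ∏ i, α i ^ ((2 : ℤ) * μ i) = 1 := by
    have hsq : (∏ i, ((σ i : ℚ) * α i) ^ μ i) ^ 2 = 1 := by rw [h, one_pow]
    rw [← prod_pow] at hsq
    rw [← hsq]
    refine prod_congr rfl fun i _ => ?_
    rw [← zpow_natCast, ← zpow_mul, mul_zpow, mul_comm (μ i)]
    push_cast
    have hs : ((σ i : ℚ)) ^ ((2 : ℤ) * μ i) = 1 := by
      rw [zpow_mul]
      rcases hσ i with hh | hh <;> rw [hh] <;> norm_num
    rw [hs, one_mul]
  have := hμ _ h2
  funext i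
  have hi := congrFun this i
  simp only [Pi.zero_apply, mul_eq_zero, OfNat.ofNat_ne_zero, false_or] at hi
  exact hi

/-! ### The reduction -/

/-- **The W80-shape engine at `p ≡ 3 (mod 4)` from the core bound** (verbatim the hypothesis `hE` of
`YuNinetyW80.threeModFour_of_w80Engine`, with the constant `m ↦ C m` for `m ≥ 1`).
[cite: Yu1990, Theorem 2.1] [cite: Waldschmidt1980, §3.6 (p. 275)] -/
theorem engineW80_of_coreBound {C : ℕ → ℝ} {c₁ : ℝ} (hc₁ : 1 ≤ c₁) (hC2 : ∀ m, 1 ≤ m → 2 ≤ C m)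
    (henv : ∀ m, 1 ≤ m → C m ≤ c₁ ^ m * (m : ℝ) ^ m) (hcore : TwistCoreBound C) :
    ∃ (C : ℕ → ℝ) (c₁ : ℝ), 1 ≤ c₁ ∧ (∀ m, 0 ≤ C m ∧ C m ≤ c₁ ^ m * (m : ℝ) ^ m) ∧
      ∀ (p : ℕ), p.Prime → p % 4 = 3 → ∀ (m : ℕ) (α : Fin m → ℚ) (b : Fin m → ℤ) (V : Fin m → ℝ)
        (Vmax W : ℝ),
        (∀ j, α j ≠ 0 ∧ padicValRat p (α j) = 0) →
        (∀ μ : Fin m → ℤ, ∏ j, α j ^ μ j = 1 → μ = 0) →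
        (∀ T : Finset (Fin m), T.Nonempty → ¬ IsSquare (∏ j ∈ T, α j) ∧ ¬ IsSquare (-∏ j ∈ T, α j)) →
        (∀ j, Height.logHeight₁ (α j) ≤ V j) → (∀ j, Real.log p ≤ V j) → (∀ j, V j ≤ Vmax) →
        b ≠ 0 → (∀ j, Real.log (max 3 (|b j| : ℝ)) ≤ W) → Real.log p ≤ W →
        (padicValRat p (∏ j, α j ^ b j - 1) : ℝ) ≤
          C m * p * (∏ j, V j / Real.log p) * (W + Real.log (2 * Vmax)) * Real.log (2 * Vmax) := by
  classical
  refine ⟨fun m => if m = 0 then 1 else C m, c₁, hc₁, fun m => ?_, ?_⟩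
  · by_cases hm : m = 0
    · subst hm; simp
    · simp only [if_neg hm]
      have h1 := Nat.one_le_iff_ne_zero.mpr hm
      exact ⟨by linarith [hC2 m h1], henv m h1⟩
  intro p hp hp4 m α b V Vmax W hα hmult hK hV hVp hVmax hb hW hWp
  haveI : Fact p.Prime := ⟨hp⟩
  have hp3 : 3 ≤ p := by have := hp.two_le; omega
  -- `m = d + 1`
  obtain ⟨d, rfl⟩ : ∃ d, m = d + 1 := by
    rcases m with - | d
    · exact absurd (Subsingleton.elim b 0) hb
    · exact ⟨d, rfl⟩
  simp only [Nat.succ_ne_zero, if_false]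
  -- positivity bookkeeping for the right-hand side
  have hlp : 1 < Real.log p := by
    rw [← Real.exp_lt_exp, Real.exp_log (by exact_mod_cast hp.pos)]
    refine lt_of_lt_of_le ?_ (by exact_mod_cast hp3 : (3 : ℝ) ≤ p)
    have := Real.exp_one_lt_d9; norm_num at this ⊢; linarith
  have hlp0 : 0 < Real.log p := by linarith
  have hVpos : ∀ i, 0 < V i := fun i => hlp0.trans_le (hVp i)
  have hVl1 : ∀ i, 1 ≤ V i / Real.log p := fun i => by rw [le_div_iff₀ hlp0, one_mul]; exact hVp i
  have hprod1 : 1 ≤ ∏ i, V i / Real.log p := by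
    calc (1 : ℝ) = ∏ _i : Fin (d + 1), (1 : ℝ) := by simp
      _ ≤ ∏ i, V i / Real.log p := prod_le_prod (fun _ _ => zero_le_one) fun i _ => hVl1 i
  have hlog3 : 1 < Real.log 3 := by
    rw [Real.lt_log_iff_exp_lt (by norm_num)]
    have := Real.exp_one_lt_d9; linarith
  obtain ⟨j₀⟩ : Nonempty (Fin (d + 1)) := ⟨0⟩
  have hVmax3 : Real.log 3 ≤ Vmax := by
    calc Real.log 3 ≤ Real.log p := Real.log_le_log (by norm_num) (by exact_mod_cast hp3)
      _ ≤ V j₀ := hVp j₀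
      _ ≤ Vmax := hVmax j₀
  have hl2V : Real.log 2 ≤ Real.log (2 * Vmax) := Real.log_le_log two_pos (by linarith)
  have hl2V0 : 0 < Real.log (2 * Vmax) := lt_of_lt_of_le (Real.log_pos one_lt_two) hl2V
  have hl2 : (1 : ℝ) / 2 < Real.log 2 := by have := Real.log_two_gt_d9; linarith
  have hW3 : Real.log 3 ≤ W := le_trans (Real.log_le_log (by norm_num) (le_max_left _ _)) (hW j₀)
  have hW0 : 0 < W := by linarith
  have hC0 : 0 ≤ C (d + 1) := by linarith [hC2 (d + 1) d.succ_pos]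
  have hp0 : (0 : ℝ) < p := by exact_mod_cast hp.pos
  have hRHS0 : 0 ≤ C (d + 1) * p * (∏ j, V j / Real.log p) * (W + Real.log (2 * Vmax)) * Real.log (2 * Vmax) := by
    have : 0 ≤ W + Real.log (2 * Vmax) := by linarith
    positivity
  -- the trivial case `ord_p(Θ₀ − 1) ≤ 0`
  set Θ₀ : ℚ := ∏ j, α j ^ b j with hΘ₀
  by_cases hv : padicValRat p (Θ₀ - 1) < 1
  · have : (padicValRat p (Θ₀ - 1) : ℝ) ≤ 0 := by exact_mod_cast (show padicValRat p (Θ₀ - 1) ≤ 0 by omega)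
    exact this.trans hRHS0
  push Not at hv
  have hΘ₀1 : Θ₀ - 1 ≠ 0 := by
    intro h0; rw [h0, padicValRat.zero] at hv; exact absurd hv (by norm_num)
  have hΘ₀ne : Θ₀ ≠ 0 := prod_ne_zero_iff.mpr fun j _ => zpow_ne_zero _ (hα j).1
  have hnormΘ : ‖((Θ₀ - 1 : ℚ) : ℚ_[p])‖ = (p : ℝ) ^ (-padicValRat p (Θ₀ - 1)) := by
    rw [Padic.norm_eq_zpow_neg_valuation (by exact_mod_cast hΘ₀1), Padic.valuation_ratCast]
  have hprinΘ : ‖(Θ₀ : ℚ_[p]) - 1‖ ≤ (p : ℝ)⁻¹ := by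
    have e : (Θ₀ : ℚ_[p]) - 1 = ((Θ₀ - 1 : ℚ) : ℚ_[p]) := by push_cast; ring
    rw [e, hnormΘ, ← zpow_neg_one]
    exact zpow_le_zpow_right₀ (by exact_mod_cast hp.one_lt.le) (by linarith)
  -- an index with `b ≠ 0` of minimal `p`-adic order
  set I : Finset (Fin (d + 1)) := univ.filter fun i => b i ≠ 0 with hI
  have hIne : I.Nonempty := by
    by_contra hne
    rw [Finset.not_nonempty_iff_eq_empty] at hne
    apply hb; funext i
    by_contra hbi
    have : i ∈ I := by rw [hI, mem_filter]; exact ⟨mem_univ _, hbi⟩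
    rw [hne] at this; simp at this
  obtain ⟨i₀, hi₀I, hmin⟩ := I.exists_min_image (fun i => padicValInt p (b i)) hIne
  have hbi₀ : b i₀ ≠ 0 := by rw [hI, mem_filter] at hi₀I; exact hi₀I.2
  -- the twist
  obtain ⟨σ, η, hσ, hηG, hprin⟩ := twist_exists_family hp4 α hα
  set α' : Fin (d + 1) → ℚ := fun i => (σ i : ℚ) * α i with hα'
  have hσne : ∀ i, (σ i : ℚ) ≠ 0 := fun i => by rcases hσ i with h | h <;> rw [h] <;> norm_num
  have hα'ne : ∀ i, α' i ≠ 0 := fun i => mul_ne_zero (hσne i) (hα i).1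
  -- the set-up
  let S : TwistSetup p :=
    { hp3 := hp3, d := d, α := fun j => α' (i₀.succAbove j), θ := α' i₀,
      α_ne := fun j => hα'ne _, θ_ne := hα'ne _,
      b := fun j => b (i₀.succAbove j), bθ := b i₀, bθ_ne := hbi₀,
      hbmin := fun j hj => hmin _ (by rw [hI, mem_filter]; exact ⟨mem_univ _, hj⟩),
      G := (p - 1) / 2, hG := (odd_half_sub_one hp4).pos,
      η := fun i => η (reidxEquiv i₀ i), hηG := fun i => hηG _,
      hprin := fun i => by
        have e : ((Fin.snoc (α := fun _ => ℚ) (fun j => α' (i₀.succAbove j)) (α' i₀) : Fin (d + 1) → ℚ) i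
            : ℚ_[p]) = ((((σ (reidxEquiv i₀ i) : ℚ) * α (reidxEquiv i₀ i) : ℚ)) : ℚ_[p]) := by
          rw [snoc_comp_succAbove α' i₀ i]
        rw [e]; exact hprin _ }
  -- `S.toQ.all = α' ∘ e`
  have hall : ∀ i, S.toQ.all i = α' (reidxEquiv i₀ i) := fun i => snoc_comp_succAbove α' i₀ i
  -- transport the Kummer condition
  have hK' : ∀ T : Finset (Fin (S.d + 1)), T.Nonempty → ¬ IsSquare (∏ i ∈ T, S.toQ.all i) := by
    intro T hT
    have e1 : ∏ i ∈ T, S.toQ.all i = ∏ j ∈ T.map (reidxEquiv i₀).toEmbedding, α' j := by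
      rw [Finset.prod_map]; exact prod_congr rfl fun i _ => hall i
    rw [e1]
    exact not_isSquare_prod_sign_mul α σ hσ hK _ (by simpa using hT)
  -- transport the multiplicative independence
  have hmult' : ∀ μ : Fin (S.d + 1) → ℤ, ∏ i, S.toQ.all i ^ μ i = 1 → μ = 0 := by
    intro μ hμ
    have e1 : ∏ i, S.toQ.all i ^ μ i = ∏ j, α' j ^ μ ((reidxEquiv i₀).symm j) := by
      rw [← (reidxEquiv i₀).prod_comp (fun j => α' j ^ μ ((reidxEquiv i₀).symm j))]
      exact prod_congr rfl fun i _ => by rw [hall, Equiv.symm_apply_apply]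
    rw [e1] at hμ
    have h0 := indep_sign_mul α σ hσ hmult _ hμ
    funext i
    have := congrFun h0 (reidxEquiv i₀ i)
    simpa using this
  -- heights of signed generators
  have hh' : ∀ i, logHeight₁ (α' i) = logHeight₁ (α i) := by
    intro i; simp only [hα']
    rcases hσ i with h | h
    · rw [h]; simp
    · rw [h]; push_cast; rw [neg_one_mul, logHeight₁_neg]
  -- the core bound
  have hΛ₀ := hcore p S (fun j => V (i₀.succAbove j)) (V i₀) Vmax W (odd_half_sub_one hp4)
    (show (p - 1) / 2 ≤ p by omega) hK' hmult'
    (fun j => by change logHeight₁ (α' _) ≤ _; rw [hh']; exact hV _)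
    (by change logHeight₁ (α' _) ≤ _; rw [hh']; exact hV _)
    (fun j => hVp _) (hVp i₀) (fun j => hVmax _) (hVmax i₀) (fun j => hW _) (hW i₀) hWp
  -- `(∏ⱼ V(succAbove j)/ℓ) · V i₀/ℓ = ∏ᵢ Vᵢ/ℓ`
  have hprodV : (∏ j : Fin d, V (i₀.succAbove j) / Real.log p) * (V i₀ / Real.log p) =
      ∏ i, V i / Real.log p := by
    rw [Fin.prod_univ_succAbove (fun i => V i / Real.log p) i₀, mul_comm]
  set U : ℝ := C (d + 1) * ((p - 1) / 2 : ℕ) * (∏ i, V i / Real.log p) * (W + Real.log (2 * Vmax)) *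
    Real.log (2 * Vmax) with hU
  have hΛ₀' : Real.exp (-U) < ‖S.Λ₀‖ := by
    have : C (S.d + 1) * S.G * ((∏ j : Fin S.d, V (i₀.succAbove j) / Real.log p) * (V i₀ / Real.log p)) *
        (W + Real.log (2 * Vmax)) * Real.log (2 * Vmax) = U := by
      rw [hU]
      change C (d + 1) * (((p - 1) / 2 : ℕ) : ℝ) *
        ((∏ j : Fin d, V (i₀.succAbove j) / Real.log p) * (V i₀ / Real.log p)) * _ * _ = _
      rw [hprodV]
    rw [this] at hΛ₀; exact hΛ₀
  have hG1 : (1 : ℝ) ≤ (((p - 1) / 2 : ℕ) : ℝ) := by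
    exact_mod_cast (show 1 ≤ (p - 1) / 2 by omega)
  have hGp : (((p - 1) / 2 : ℕ) : ℝ) ≤ (p : ℝ) / 2 := by
    have h1 : (((p - 1) / 2 : ℕ) : ℝ) ≤ ((p - 1 : ℕ) : ℝ) / 2 := Nat.cast_div_le
    have h2 : ((p - 1 : ℕ) : ℝ) ≤ p := by exact_mod_cast Nat.sub_le p 1
    linarith
  have hU0 : 0 ≤ U := by
    rw [hU]
    have : 0 ≤ W + Real.log (2 * Vmax) := by linarith
    positivity
  -- `W ≤ U`
  have hWU : W ≤ U := by
    rw [hU]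
    have hC2' := hC2 (d + 1) d.succ_pos
    have h1 : W ≤ C (d + 1) * (W + Real.log (2 * Vmax)) * Real.log (2 * Vmax) := by
      calc W = 2 * W * (1 / 2) := by ring
        _ ≤ C (d + 1) * (W + Real.log (2 * Vmax)) * Real.log (2 * Vmax) := by
            refine mul_le_mul (mul_le_mul hC2' (by linarith) hW0.le (by linarith)) (by linarith)
              (by norm_num) (by positivity)
    calc W ≤ C (d + 1) * (W + Real.log (2 * Vmax)) * Real.log (2 * Vmax) := h1
      _ = C (d + 1) * 1 * 1 * (W + Real.log (2 * Vmax)) * Real.log (2 * Vmax) := by ring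
      _ ≤ C (d + 1) * (((p - 1) / 2 : ℕ) : ℝ) * (∏ i, V i / Real.log p) * (W + Real.log (2 * Vmax)) *
            Real.log (2 * Vmax) := by
          have : 0 ≤ W + Real.log (2 * Vmax) := by linarith
          gcongr
  -- `S.Θ = ε · Θ₀` with a sign `ε`
  have hΘ : S.Θ = (∏ i, (σ i : ℚ) ^ b i) * Θ₀ := by
    change (∏ j : Fin d, α' (i₀.succAbove j) ^ b (i₀.succAbove j)) * α' i₀ ^ b i₀ = _
    rw [hΘ₀, ← prod_mul_distrib, Fin.prod_univ_succAbove (fun i => (σ i : ℚ) ^ b i * α i ^ b i) i₀,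
      mul_comm]
    congr 1
    · simp only [hα', mul_zpow]
    · exact prod_congr rfl fun j _ => by simp only [hα', mul_zpow]
  -- the sign is `+1`: otherwise `−ρ_b` would be a principal unit with `(−ρ_b)^G = −1`
  have hε : (∏ i, (σ i : ℚ) ^ b i) = 1 := by
    rcases prod_sign_eq univ σ hσ b with h1 | hneg
    · exact h1
    · exfalso
      -- `Ω = S.Θ · ρ_b = −Θ₀ ρ_b` is principal and so is `Θ₀`; hence `x := −ρ_b` is principal
      have hΩ : ‖1 - (S.Θ : ℚ_[p]) * S.ηb‖ ≤ (p : ℝ)⁻¹ := by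
        rw [← S.prod_ω_zpow_eq]; exact S.norm_one_sub_prod_ω_zpow_le
      have hΘ₀p : ‖1 - (Θ₀ : ℚ_[p])‖ ≤ (p : ℝ)⁻¹ := by rwa [norm_sub_rev] at hprinΘ
      have hΘ₀p' : (Θ₀ : ℚ_[p]) ≠ 0 := by exact_mod_cast hΘ₀ne
      have hx : ‖1 - (-S.ηb)‖ ≤ (p : ℝ)⁻¹ := by
        have e : -S.ηb = ((S.Θ : ℚ_[p]) * S.ηb) * (Θ₀ : ℚ_[p])⁻¹ := by
          rw [hΘ, hneg]; push_cast; field_simp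
        rw [e]
        exact PadicExp.norm_one_sub_mul_le S.inv_p_lt_one hΩ
          (PadicExp.norm_one_sub_inv_le S.inv_p_lt_one hΘ₀p)
      have hxG : (-S.ηb) ^ S.G = -1 := by
        rw [neg_pow, S.ηb_pow_G, (odd_half_sub_one hp4).neg_one_pow]; norm_num
      -- a principal unit has principal powers: `‖1 − x^G‖ ≤ p⁻¹ < 1 = ‖1 − (−1)‖ = ‖2‖`
      have hpow : ‖1 - (-S.ηb) ^ S.G‖ ≤ (p : ℝ)⁻¹ := by
        have := PadicExp.norm_one_sub_zpow_le S.inv_p_nonneg S.inv_p_lt_one hx (S.G : ℤ)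
        rwa [zpow_natCast] at this
      rw [hxG, sub_neg_eq_add, one_add_one_eq_two, PadicExp.norm_two_eq_one S.hp3] at hpow
      exact absurd hpow (not_le.mpr S.inv_p_lt_one)
  have hΘ' : S.Θ = Θ₀ := by rw [hΘ, hε, one_mul]
  -- `‖Λ‖ = ‖Θ₀ − 1‖_p = ‖b_θ‖ ‖Λ₀‖ > e^{−W} e^{−U}`
  have hnorm' : ‖((Θ₀ - 1 : ℚ) : ℚ_[p])‖ = ‖(S.bθ : ℚ_[p])‖ * ‖S.Λ₀‖ := by
    rw [← S.norm_Λ_eq_mul, S.norm_Λ_of_principal (by rw [hΘ']; exact hprinΘ), hΘ']; push_cast; rfl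
  have hbθ : Real.exp (-W) ≤ ‖(S.bθ : ℚ_[p])‖ := by
    change Real.exp (-W) ≤ ‖((b i₀ : ℤ) : ℚ_[p])‖
    have habs0 : 0 < |(b i₀ : ℝ)| := abs_pos.mpr (by exact_mod_cast hbi₀)
    have h1 : (1 : ℝ) / |(b i₀ : ℝ)| ≤ ‖((b i₀ : ℤ) : ℚ_[p])‖ := one_div_le_norm_intCast hbi₀
    have hle : |(b i₀ : ℝ)| ≤ Real.exp W := by
      have hlogb : Real.log |(b i₀ : ℝ)| ≤ W :=
        (Real.log_le_log habs0 (le_max_right _ _)).trans (hW i₀)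
      calc |(b i₀ : ℝ)| = Real.exp (Real.log |(b i₀ : ℝ)|) := (Real.exp_log habs0).symm
        _ ≤ Real.exp W := Real.exp_le_exp.mpr hlogb
    calc Real.exp (-W) = 1 / Real.exp W := by rw [Real.exp_neg, one_div]
      _ ≤ 1 / |(b i₀ : ℝ)| := one_div_le_one_div_of_le habs0 hle
      _ ≤ ‖((b i₀ : ℤ) : ℚ_[p])‖ := h1
  have hkey : Real.exp (-(U + W)) < (p : ℝ) ^ (-padicValRat p (Θ₀ - 1)) := by
    rw [← hnormΘ, hnorm', show -(U + W) = -W + -U by ring, Real.exp_add]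
    exact mul_lt_mul' hbθ hΛ₀' (Real.exp_pos _).le (lt_of_lt_of_le (Real.exp_pos _) hbθ)
  -- take logarithms: `v log p < U + W ≤ 2U`, and `2U/log p ≤ C p ∏(V/log p) (W + L) L`
  have hlog := Real.log_lt_log (Real.exp_pos _) hkey
  rw [Real.log_exp, Real.log_zpow] at hlog
  push_cast at hlog
  -- `v · log p ≤ 2U`
  have hv2 : (padicValRat p (Θ₀ - 1) : ℝ) * Real.log p ≤ 2 * U := by nlinarith [hlog, hWU]
  -- `2U ≤ log p · RHS`
  have h2U : 2 * U ≤ Real.log p *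
      (C (d + 1) * p * (∏ j, V j / Real.log p) * (W + Real.log (2 * Vmax)) * Real.log (2 * Vmax)) := by
    rw [hU]
    have hWL : 0 ≤ W + Real.log (2 * Vmax) := by linarith
    have hGp' : 2 * (((p - 1) / 2 : ℕ) : ℝ) ≤ Real.log p * p := by
      calc 2 * (((p - 1) / 2 : ℕ) : ℝ) ≤ p := by linarith
        _ = 1 * p := (one_mul _).symm
        _ ≤ Real.log p * p := mul_le_mul_of_nonneg_right hlp.le hp0.le
    calc 2 * (C (d + 1) * (((p - 1) / 2 : ℕ) : ℝ) * (∏ i, V i / Real.log p) * (W + Real.log (2 * Vmax)) *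
          Real.log (2 * Vmax))
        = (2 * (((p - 1) / 2 : ℕ) : ℝ)) * (C (d + 1) * (∏ i, V i / Real.log p) * (W + Real.log (2 * Vmax)) *
          Real.log (2 * Vmax)) := by ring
      _ ≤ (Real.log p * p) * (C (d + 1) * (∏ i, V i / Real.log p) * (W + Real.log (2 * Vmax)) *
          Real.log (2 * Vmax)) := mul_le_mul_of_nonneg_right hGp' (by positivity)
      _ = _ := by ring
  have hfin := hv2.trans h2U
  rw [mul_comm (Real.log p)] at hfin
  exact le_of_mul_le_mul_right hfin hlp0

end TwistSetup

end Summit.ABC.StewartYu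

end
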